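import Literature.ModelTheory.ExponentialFields.PilaWilkieCellParametrization
import Literature.ModelTheory.ExponentialFields.OMinimalCellDecomposition
import Literature.ModelTheory.ExponentialFields.OMinimalCellFibres
import HarnessLib

/-!
# `r`-parametrization of the fibres of a definable family (Pila–Wilkie 2006, §5 `(II)_m` with Cor. 5.2)

Topic `Literature/ModelTheory/ExponentialFields`; proof file in the cone of the named fact
`PilaWilkie2006_thm_1_8`, continuing `PilaWilkieCellParametrization.lean`.

* (from the tree's `OMinimalCellFibres`: `IsCell.fibre` — the non-empty fibre of a cell is a
  cell whose type is the list of the last `M` type bits;) `definableFun_append_right`;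
* `definable_setOf_fibre_nonempty` — `{v | Z_v ≠ ∅}` is definable;
* `familyParam` — **Pila–Wilkie 2006, `(II)_m` for all fibres of a definable family at once**
  (the uniformity of Cor. 5.2, *"there exists `N(Z, r)` such that for each `y ∈ Y`, the fibre
  `Z_y` has an `r`-parametrisation consisting of at most `N(Z, r)` maps"*, obtained here
  without saturation, by decomposing the total space into cells and parametrizing cell fibres
  with `cellFibreParam`), modulo the uniform `r`-reparametrization property `UR(r, ℓ)`,
  `ℓ < M`, stated inline: finitely many definable families of charts
  `φ_j(v,·) : (0,1)^{ℓ_j} → Z_v` with definable activity conditions, covering `Z_v`, `C^r`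
  with all Fréchet derivatives of order `≤ r` bounded by `1`, and `ℓ_j ≤ dim Z_v` for the
  active ones.

Nothing here is a named fact; no definitions.

## References

* J. Pila, A. J. Wilkie, *The rational points of a definable set*, Duke Math. J. 133 (2006),
  §5, Cor. 5.2. [PilaWilkie2006]
* L. van den Dries, *Tame topology and o-minimal structures*, CUP 1998, Ch. 3 (cells,
  decompositions), Ch. 4 (dimension). [Dries1998]
-/

noncomputable section

open Set FirstOrder FirstOrder.Language Filter Topology

namespace Literature.ModelTheory.ExponentialFields

/-! ### Fibres: a definability helper -/

section CellFibres

variable {L : Language} [L.Structure ℝ]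

/-- For a definable `f : ℝ^{p+M} → ℝ` and `v ∈ ℝ^p`, `z ↦ f(v ⧺ z)` is definable (with
parameters). [folklore] -/
theorem definableFun_append_right {p M : ℕ} {f : (Fin (p + M) → ℝ) → ℝ}
    (hf : (univ : Set ℝ).DefinableFun L f) (v : Fin p → ℝ) :
    (univ : Set ℝ).DefinableFun L (fun z : Fin M → ℝ => f (Fin.append v z)) :=
  (isDefinableFamily_append hf).definableFun (fun b => definableFun_const' _ (v b)) (fun d => definableFun_proj d)

end CellFibres

/-! ### `(II)` for definable families (Pila–Wilkie 2006, §5 with Cor. 5.2) -/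

section FamilyParam

open Classical

variable {L : Language} [L.Structure ℝ]

/-- Local notation: the open unit cube `(0,1)^ℓ`. -/
local notation "𝕀^" ℓ:max => (Set.pi Set.univ fun _ : Fin ℓ => Set.Ioo (0 : ℝ) 1)

/-- The set of parameters with non-empty fibre is definable. [folklore] -/
theorem definable_setOf_fibre_nonempty {p M : ℕ} {C : Set (Fin (p + M) → ℝ)}
    (hC : (univ : Set ℝ).Definable L C) :
    (univ : Set ℝ).Definable L {v : Fin p → ℝ | {z : Fin M → ℝ | (Fin.append v z :) ∈ C}.Nonempty} := by
  have h := hC.image_comp (Fin.castAdd M : Fin p → Fin (p + M))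
  convert h using 1
  ext v
  simp only [mem_setOf_eq, mem_image]
  constructor
  · rintro ⟨z, hz⟩
    refine ⟨Fin.append v z, hz, ?_⟩
    funext b; simp
  · rintro ⟨w, hw, rfl⟩
    refine ⟨fun d => w (Fin.natAdd p d), ?_⟩
    show (Fin.append (w ∘ Fin.castAdd M) (fun d => w (Fin.natAdd p d)) :) ∈ C
    convert hw using 1
    funext k
    refine Fin.addCases (fun b => ?_) (fun d => ?_) k <;> simp

/-- **`r`-parametrization of the fibres of a definable family, uniformly** (Pila–Wilkie 2006,
§5 `(II)_m` with the uniformity of Cor. 5.2: *"Then there exists `N(Z, r) ∈ ℕ` such that for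
each `y ∈ Y`, the fibre `Z_y` has an `r`-parametrisation consisting of at most `N(Z, r)`
maps"*), modulo the uniform `r`-reparametrization property `UR(r, ℓ)` for `ℓ < M`: for a
definable `Z ⊆ ℝ^{p+M}` whose fibres `Z_v` lie in `(0,1)^M` there are finitely many definable
families of charts `φ_j(v, ·) : (0,1)^{ℓ_j} → ℝ^M` with definable activity conditions `A_j`
such that for every `v`: `Z_v = ⋃_{j active} φ_j(v, (0,1)^{ℓ_j})`, and each active chart maps
into `Z_v`, is `C^r` with all Fréchet derivatives of order `≤ r` bounded by `1`, and has
`ℓ_j ≤ dim Z_v`. (Cells of a decomposition of the total space partitioning `Z`, then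
`cellFibreParam` cell by cell; `ℓ_j` is the dimension of the fibre cell.)
[cite: PilaWilkie2006, §5 (II)_m, Cor. 5.2] -/
theorem familyParam {p M r : ℕ} (hO : L.IsOMinimal ℝ)
    (hadd : (univ : Set ℝ).Definable L {v : Fin 3 → ℝ | v 0 + v 1 = v 2})
    (hmul : (univ : Set ℝ).Definable L {v : Fin 3 → ℝ | v 0 * v 1 = v 2})
    (hUR : ∀ ℓ, ℓ < M → ∀ (n m : ℕ) (F : Fin n → (Fin m → ℝ) → (Fin ℓ → ℝ) → ℝ),
      (∀ l, IsDefinableFamily L (F l)) → (∀ l v, ∀ x ∈ 𝕀^ℓ, |F l v x| ≤ 1) →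
      ∃ (κ : Type) (_ : Fintype κ) (ψ : κ → (Fin m → ℝ) → (Fin ℓ → ℝ) → (Fin ℓ → ℝ)),
        (∀ j c, IsDefinableFamily L (fun v x => ψ j v x c)) ∧
        ∀ v, (∀ j, MapsTo (ψ j v) (𝕀^ℓ) (𝕀^ℓ)) ∧ (⋃ j, ψ j v '' 𝕀^ℓ) = 𝕀^ℓ ∧
          (∀ j c, ContDiffOn ℝ r (fun x => ψ j v x c) (𝕀^ℓ)) ∧
          (∀ j c, ∀ q ≤ r, ∀ x ∈ 𝕀^ℓ, ‖iteratedFDeriv ℝ q (fun x => ψ j v x c) x‖ ≤ 1) ∧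
          (∀ j l, ContDiffOn ℝ r (fun x => F l v (ψ j v x)) (𝕀^ℓ)) ∧
          (∀ j l, ∀ q ≤ r, ∀ x ∈ 𝕀^ℓ, ‖iteratedFDeriv ℝ q (fun x => F l v (ψ j v x)) x‖ ≤ 1))
    (Z : Set (Fin (p + M) → ℝ)) (hZ : (univ : Set ℝ).Definable L Z)
    (hZsub : ∀ v : Fin p → ℝ, {z : Fin M → ℝ | (Fin.append v z :) ∈ Z} ⊆ 𝕀^M) :
    ∃ (κ : Type) (_ : Fintype κ) (ℓ : κ → ℕ) (A : κ → (Fin p → ℝ) → Prop)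
      (φ : ∀ j, (Fin p → ℝ) → (Fin (ℓ j) → ℝ) → (Fin M → ℝ)),
      (∀ j, ℓ j ≤ M) ∧ (∀ j, (univ : Set ℝ).Definable L {v | A j v}) ∧
      (∀ j c, IsDefinableFamily L (fun v x => φ j v x c)) ∧
      ∀ v : Fin p → ℝ,
        {z : Fin M → ℝ | (Fin.append v z :) ∈ Z} = ⋃ j, ⋃ (_ : A j v), φ j v '' 𝕀^(ℓ j) ∧
        ∀ j, A j v →
          MapsTo (φ j v) (𝕀^(ℓ j)) {z : Fin M → ℝ | (Fin.append v z :) ∈ Z} ∧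
          (∀ c, ContDiffOn ℝ r (fun x => φ j v x c) (𝕀^(ℓ j))) ∧
          (∀ c, ∀ q ≤ r, ∀ x ∈ 𝕀^(ℓ j), ‖iteratedFDeriv ℝ q (fun x => φ j v x c) x‖ ≤ 1) ∧
          ℓ j ≤ CellDimension.dim L M {z : Fin M → ℝ | (Fin.append v z :) ∈ Z} := by
  have hlt := definable_lt_of_field hadd hmul
  obtain ⟨𝒟, h𝒟, hpart⟩ := CellDecomposition.cellDecomposition_I hO hlt {Z} (by simpa using hZ)
  -- the cells inside `Z`, with chosen types
  set 𝒟Z : Finset (Set (Fin (p + M) → ℝ)) := 𝒟.filter fun C => C ⊆ Z with h𝒟Z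
  have hmemZ : ∀ C : 𝒟Z, (C.1 ∈ 𝒟) ∧ C.1 ⊆ Z := fun C =>
    Finset.mem_filter.mp C.2
  have hcell : ∀ C : 𝒟Z, ∃ ι, IsCell L (p + M) ι C.1 := fun C => h𝒟.isCell C.1 (hmemZ C).1
  choose ι hι using hcell
  have hsub : ∀ (C : 𝒟Z) (v : Fin p → ℝ), {z : Fin M → ℝ | (Fin.append v z :) ∈ C.1} ⊆ 𝕀^M :=
    fun C v z hz => hZsub v ((hmemZ C).2 hz)
  have hpar := fun C : 𝒟Z => cellFibreParam (p := p) (r := r) hadd hmul M hUR (ι C) C.1 (hι C) (hsub C)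
  choose ℓ κ hκ φ hℓ hφdef hφ using hpar
  refine ⟨Σ C : 𝒟Z, κ C, inferInstance, fun j => ℓ j.1,
    fun j v => {z : Fin M → ℝ | (Fin.append v z :) ∈ j.1.1}.Nonempty, fun j => φ j.1 j.2, ?_, ?_, ?_, fun v => ?_⟩
  · intro j; show ℓ j.1 ≤ M; rw [hℓ]; exact CellDimension.typeDim_le _
  · intro j; exact definable_setOf_fibre_nonempty ((hι j.1).definable hlt)
  · intro j c; exact hφdef j.1 j.2 c
  -- at a parameter `v`
  have hfibZ : {z : Fin M → ℝ | (Fin.append v z :) ∈ Z} = ⋃ C : 𝒟Z, {z : Fin M → ℝ | (Fin.append v z :) ∈ C.1} := by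
    ext z
    simp only [mem_setOf_eq, mem_iUnion]
    constructor
    · intro hz
      obtain ⟨C, hC, hzC⟩ := h𝒟.exists_mem (Fin.append v z)
      have hCZ : C ⊆ Z := by
        rcases hpart Z (Finset.mem_singleton_self Z) C hC with h | h
        · exact h
        · exact absurd hz (disjoint_left.mp h hzC)
      exact ⟨⟨C, Finset.mem_filter.mpr ⟨hC, hCZ⟩⟩, hzC⟩
    · rintro ⟨C, hzC⟩
      exact (hmemZ C).2 hzC
  constructor
  · rw [hfibZ]
    ext z
    simp only [mem_iUnion, mem_setOf_eq]
    constructor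
    · rintro ⟨C, hzC⟩
      have hne : {z : Fin M → ℝ | (Fin.append v z :) ∈ C.1}.Nonempty := ⟨z, hzC⟩
      have hcov := (hφ C v hne).2.1
      have hz' : z ∈ ⋃ i, φ C i v '' 𝕀^(ℓ C) := by rw [hcov]; exact hzC
      obtain ⟨i, hi⟩ := mem_iUnion.mp hz'
      exact ⟨⟨C, i⟩, hne, hi⟩
    · rintro ⟨⟨C, i⟩, hne, hi⟩
      exact ⟨C, (hφ C v hne).1 i |>.image_subset hi⟩
  · rintro ⟨C, i⟩ hne
    obtain ⟨hmaps, -, hCr, hbd⟩ := hφ C v hne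
    refine ⟨fun x hx => ?_, hCr i, hbd i, ?_⟩
    · show (Fin.append v (φ C i v x) :) ∈ Z
      exact (hmemZ C).2 (hmaps i hx)
    · -- the fibre cell witnesses the dimension
      have hfc := IsCell.fibre (hι C) v hne
      show ℓ C ≤ _
      rw [hℓ C]
      exact CellDimension.typeDim_le_dim hfc fun z hz => (hmemZ C).2 hz

end FamilyParam


end Literature.ModelTheory.ExponentialFields

end
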